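import Literature.AlgebraicGeometry.ComplexMultiplication.CyclotomicFermatCMTypesPrimePowerParityCriterion
import HarnessLib

/-!
# Koblitz–Rohrlich at prime-power level: ALL coincidences `H_τ = H_{τ′}` — THEOREM 1 (i) IN FULL (the §3 Proposition, boundary
# cases included) at every odd prime-power level `pⁿ`, `p ≥ 5`, and THEOREM 3 (the §4 Proposition, `N = 3ⁿ`) for EVERY `n`

Layer `Literature/AlgebraicGeometry/ComplexMultiplication`, namespace `…ComplexMultiplication.CyclotomicFermatCMType`; sequel of
`CyclotomicFermatCMTypesPrimePowerParityCriterion` (the parity condition forced by `H_τ = H_{τ′}` at prime-power level) and of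
`CyclotomicFermatCMTypesPrimePowerLevelSimple` (the relatively prime case: unit triples).  THEOREMS ONLY (no definition, no named
fact, no `sorry`; kernel `decide` only for the three numerical instances of the exceptional pair at `9, 27, 81`).  Before this file the
tree had K–R's boundary-case Proposition only at `N = 25` (and `35`) and Theorem 3's completeness only at `N = 9, 27`, by kernel
enumeration (`CyclotomicFermatCMTypesBoundaryCaseInstances`, `…ThreePowerLevelIsogenies`, `…ThreePowerLevelTwentySeven`); the
siblings' honest columns: "general `N` and the printed proof (Cases 1–3, Lemma p. 1195) NOT typed", "general `n` NOT typed".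

THE SOURCE.  N. Koblitz, D. Rohrlich, *Simple factors in the Jacobian of a Fermat curve*, Canad. J. Math. **30** (1978) 1183–1205
(held `paper:koblitz1978-simple-factors-jacobian-fermat-curve`).  THEOREM 1 (p. 1185): "Suppose `N` is prime to `6`.  Then: (i)
`H_{r,s,t} = H_{r′,s′,t′}` if and only if `{r, s, t} ∼ {r′, s′, t′}`."; §3 (p. 1193): "PROPOSITION.  Let `2, 3 ∤ N`, `τ = (r, s, t)`,
`τ′ = (r′, s′, t′)`, `r + s + t = N`.  Suppose g.c.d. `(r, s, t, r′, s′, t′) = 1`.  Let `H_τ = {h ∈ (ℤ/Nℤ)* | ⟨hr⟩ + ⟨hs⟩ + ⟨ht⟩ = N}`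
and similarly for `H_{τ′}`.  Suppose `N` is not prime to `rstr′s′t′`.  In the case that `r = r′` for some ordering of the triples `τ`
and `τ′`, suppose further that `N` is not prime to `sts′t′`.  Finally, suppose `H_τ = H_{τ′}`.  Then `τ′` is a permutation of `τ`.";
THEOREM 3 (p. 1186): "Suppose `N = 3ⁿ`.  Then the only isogenies apart from the obvious ones are between pairs of lattices
corresponding to the triples `(3ᵐ, 3ⁿ⁻¹ − 2(3ᵐ), 2(3ⁿ⁻¹) + 3ᵐ)` and `(3ᵐ⁺¹, 3ⁿ⁻¹ − 2(3ᵐ), 2(3ⁿ⁻¹) − 3ᵐ)` for `0 ≤ m ≤ n − 2`."; §4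
(p. 1198): "PROPOSITION. Let `N = 3ⁿ`, `N₁ = 3ⁿ⁻¹`, `τ = (r, s, t)`, `τ′ = (r′, s′, t′)`, `H_τ = H_{τ′}`.  Suppose that `τ′` is not a
permutation of `τ`, and that g.c.d.`(r, s, t, r′, s′, t′) = 1`.  Then for some `u ∈ (ℤ/Nℤ)*`, `uτ = (⟨ur⟩, ⟨us⟩, ⟨ut⟩)` and `uτ′` are
permutations of `(1, N₁ − 2, 2N₁ + 1)` and `(3, N₁ − 2, 2N₁ − 1)`."; its proof, Case 1 ("`ord s > 0` … `P = 1 + N₁(ℤ/3ℤ)` … the sum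
equals `4N` or `5N`"), Cases 2–3 ("proceeding as in Case 2 of §3, we obtain (see (6)) …"), Case 4 ("`3 ∤ s t r′ s′ t′`, `ord r = 1` …
`τ₀ = (1, N₁ − 2, 2N₁ + 1)`; then `H_{τ₀} = H_τ = H_{τ′}`").

## What is proved (level `pⁿ`; `τ = (r, s, t)`, `τ′ = (r′, s′, t′)` triples of NON-ZERO residues with `r + s + t = 0 = r′ + s′ + t′`;
## "pattern" = all units / exactly one non-unit / all non-units — `pattern_of_triple`: nothing else sums to `0`)

* §1 tools: `castHom_eq_of_pow_mul_eq` (one fibre ⟹ congruent mod `p`), `triple_eq_of_mem_of_mem` (a triple with sum `0` is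
  determined by two distinct members).
* §2 (a UNIT triple `τ` against `τ′` with exactly one non-unit `r′`): **`mem_five_of_fibre`** — the whole fibre `{y : p^{v(r′)}y = r′}`
  lies in `{r, s, t, −s′, −t′}` (parity at `y`); hence **`factorization_eq_one_of_fibre`**: `p^{v(r′)} ≤ 5`, so `v(r′) = 1`,
  `p ∈ {3, 5}`, `n ≥ 2`; `false_of_fibre_of_seven_le` (`p ≠ 3, 5`: impossible) and **`false_of_fibre_five`** (`p = 5`: the fibre would be
  all five residues, `−s′ ≡ −t′ (mod 5)`, contradicting `s′ + t′ = −r′ ≡ 0` with `s′` a unit).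
* §3: `countP_mul_eq_of_forall_not_isUnit` (non-unit counts are invariant under `g` with `g·p = p`); **`false_of_units_of_nonunits`**
  (a unit triple against a triple of non-units: `g_m r ∈ {r,s,t}` for `g_m = 1 + m pⁿ⁻¹`, so `r + s + t = 3g₁r ≠ 0`);
  **`false_of_one_nonunit_of_nonunits`** (one non-unit against three: `g₁s ∈ {s, t}`, but `g₁s ≠ s` and `g₁s ≡ s ≢ t (mod p)`).
* §4 (one non-unit on EACH side): **`eq_or_eq_of_one_nonunit`** (`s ∈ {s′, t′}` — else `−g₁s, −g₂s ∈ {s′, t′}` distinct and both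
  `≡ −s (mod p)`, while `s′ ≢ t′`) and **`multiset_eq_of_one_nonunit`**: `{r′, s′, t′} = {r, s, t}`.
* §5 **`multiset_eq_of_fermatCMType_eq_primePow_five_le` — THEOREM 1 (i) IN FULL AT `pⁿ`, `p ≥ 5`**: non-zero entries, sums `0`, a
  unit among the six (g.c.d. `= 1`), `H_{τ′} = H_τ` ⟹ `{r′, s′, t′} = {r, s, t}` — the §3 Proposition at every prime-power level
  together with the relatively prime case; K–R's provisos "`N` not prime to `rstr′s′t′`" / "`r = r′` …" only separate the cases.
* §6 **`exceptional_of_fibre_three`** (`p = 3`, a unit triple against one non-unit: `v(r′) = 1`, the fibre `{c, cu, cu²}`, `u = 1 +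
  3ⁿ⁻¹`, has exactly two members among `r, s, t` and one among `−s′, −t′`, whence `τ = {cuⁱ, cuʲ, −cuⁱ−cuʲ}`, `τ′ = {3c, −cuˡ, −cuⁱ−cuʲ}`
  and a unit `w` with `{wr, ws, wt} = {1, N₁ − 2, 2N₁ + 1}`, `{wr′, ws′, wt′} = {3, 2N₁ − 1, N₁ − 2}`), and
  **`perm_or_exceptional_of_fermatCMType_eq_threePow` — THEOREM 3 / THE §4 PROPOSITION FOR EVERY `n ≥ 1`**: non-zero entries,
  sums `0`, a unit among the six, `H_{τ′} = H_τ` ⟹ `{τ′} = {τ}`, or for a unit `w` the pair `(wτ, wτ′)` is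
  `((1, N₁−2, 2N₁+1), (3, 2N₁−1, N₁−2))` up to order within each triple, or the same with `τ, τ′` exchanged (`N₁ = 3ⁿ⁻¹` as a
  residue); `exceptional_pair_values` (the pair is `(1,1,7),(3,5,1)` mod `9`, `(1,7,19),(3,17,7)` mod `27`, `(1,25,55),(3,53,25)` mod `81`).

## Honest column / NOT here

* THE PROOFS ARE OURS: K–R prove the §3 Proposition by the coset-sum estimates (3)–(9) with a Lemma whose proof is "omitted" and
  `N = 35` "checked by hand", and the §4 Proposition by Cases 1–4 ((11), (12), a second omitted Lemma, `N = 9` "by hand").  Here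
  every configuration is read off the PARITY CONDITION of the sibling file (K–R's own §2 character argument pushed through the fibres
  of non-unit entries) plus reduction modulo `p`; the cites locate the printed statements and the printed case split
  (unit / one non-unit / all non-units = "relatively prime case" / "boundary cases" / "g.c.d. `> 1`"), not the printed estimates.
* The §3 Proposition is typed at PRIME-POWER levels `pⁿ` (`p ≥ 5`) only; K–R state it for every `N` prime to `6` — at composite
  `N = ∏pᵢ^{aᵢ}` the character argument needs the count of bad characters (`S₀(N)`, siblings `…CoprimeSixLevelSimple` etc. for UNIT
  triples) and the boundary cases there remain as in the siblings (`N = 35` by enumeration only).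
* Theorem 3 is typed in its §4-Proposition form (g.c.d. `= 1`, i.e. a unit among the six entries ⟺ K–R's g.c.d.`(r,s,t,r′,s′,t′) = 1`
  at prime-power level); the `m ≥ 1` pairs of Theorem 3 (all six entries divisible by `3ᵐ`) are the pull-backs from level `3ⁿ⁻ᵐ`
  (sibling `CyclotomicFermatCMTypesLevelPullback`) and are not restated here; "isogeny of lattices" = equality of the residue sets
  `H_τ`, as in every sibling (the lattices `L_τ`/Jacobian factors are not constructed).
* `p = 2` (Theorem 4) is out of scope (no unit triple sums to `0` modulo `2ⁿ`; K–R's §5 needs the Probabilistic Lemma).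
* Statements carry `r, s, t ≠ 0` and `r + s + t = 0` (K–R: `1 ≤ r, s, t`, `r + s + t = N`).  Private: `mem_triple_iff`, `map_mul_triple₃`,
  `triple_swap₁₂/₂₃`, `eq_one_and_of_pow_le_five`, `three_ne_zero`.

## References

* [KoblitzRohrlich1978] N. Koblitz, D. Rohrlich, Canad. J. Math. 30 (1978) 1183–1205: Theorem 1 (p. 1185), Theorem 3 (p. 1186), §2
  (pp. 1187–1188), §3 Proposition and Cases 1–3 (pp. 1193–1197), §4 Proposition and Cases 1–4 (pp. 1198–1200).

## Provenance

Cell `pub-hodgecm2` (COR-CM), literature seat `lit-deligne-3` gen 37 (claim KR78-PRIMEPOWER-COINCIDENCES; count-neutral, own lane).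
-/

noncomputable section

open NumberField

namespace Literature.AlgebraicGeometry.ComplexMultiplication

open Literature.AlgebraicGeometry.HodgeTheory (fermatCMType)

namespace CyclotomicFermatCMType

/-! ## §1 Tools: reduction modulo `p` along a fibre, triples as multisets -/

section Tools

variable {p : ℕ} [hp : Fact p.Prime] {n : ℕ}

/-- **Elements of one fibre are congruent modulo `p`**: `pᵏ·y = pᵏ·c₀` with `k < n` forces `y ≡ c₀ (mod p)` (indeed
`mod pⁿ⁻ᵏ`; K–R: "`⟨ux⟩` runs through `⟨x⟩_{N/p} + iN/p`"). [cite: KoblitzRohrlich1978, §3 proof of the Proposition, Case 1 (p. 1194)] -/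
theorem castHom_eq_of_pow_mul_eq (hn : n ≠ 0) {k : ℕ} (hk : k < n) {c₀ y : ZMod (p ^ n)}
    (h : (p : ZMod (p ^ n)) ^ k * y = (p : ZMod (p ^ n)) ^ k * c₀) :
    ZMod.castHom (dvd_pow_self p hn) (ZMod p) y = ZMod.castHom (dvd_pow_self p hn) (ZMod p) c₀ := by
  classical
  have hmem : y ∈ (Finset.univ.filter fun x : ZMod (p ^ n) => (p : ZMod (p ^ n)) ^ k * x = (p : ZMod (p ^ n)) ^ k * c₀) :=
    Finset.mem_filter.2 ⟨Finset.mem_univ _, h⟩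
  rw [filter_pow_mul_eq_image hk] at hmem
  obtain ⟨i, -, rfl⟩ := Finset.mem_image.1 hmem
  have hpd : p ∣ p ^ (n - k) := dvd_pow_self p (by omega)
  have e0 : ((p : ℕ) : ZMod p) ^ (n - k) = 0 := by
    rw [ZMod.natCast_self, zero_pow (by omega)]
  have e1 : (((c₀.val % p ^ (n - k) : ℕ) : ZMod p)) = ((c₀.val : ℕ) : ZMod p) := by
    rw [ZMod.natCast_eq_natCast_iff']
    exact Nat.mod_mod_of_dvd _ hpd
  conv_rhs => rw [← ZMod.natCast_zmod_val c₀]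
  rw [map_natCast, map_natCast]
  push_cast
  rw [e0, mul_zero, add_zero]
  exact e1

omit hp in
/-- Membership in a triple. [folklore] -/
private theorem mem_triple_iff {N : ℕ} (r s t a : ZMod N) :
    a ∈ ({r, s, t} : Multiset (ZMod N)) ↔ a = r ∨ a = s ∨ a = t := by
  simp only [Multiset.insert_eq_cons, Multiset.mem_cons, Multiset.mem_singleton]

omit hp in
/-- **A triple with sum `0` is determined by two distinct members**: if `a ≠ b` both occur in `(r, s, t)` and `r + s + t = 0`, then
`{r, s, t} = {a, b, −a−b}` ("`τ′` is a permutation of `τ`" bookkeeping). [cite: KoblitzRohrlich1978, §4 proof of the Proposition (p. 1200)] -/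
theorem triple_eq_of_mem_of_mem {N : ℕ} {r s t a b : ZMod N} (ha : a ∈ ({r, s, t} : Multiset (ZMod N)))
    (hb : b ∈ ({r, s, t} : Multiset (ZMod N))) (hab : a ≠ b) (h0 : r + s + t = 0) :
    ({r, s, t} : Multiset (ZMod N)) = {a, b, -a - b} := by
  obtain ⟨M, hM⟩ := Multiset.exists_cons_of_mem ha
  have hbM : b ∈ M := by
    have : b ∈ a ::ₘ M := hM ▸ hb
    rcases Multiset.mem_cons.1 this with h | h
    · exact absurd h.symm hab
    · exact h
  obtain ⟨M', hM'⟩ := Multiset.exists_cons_of_mem hbM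
  have hcard : Multiset.card M' = 1 := by
    have h1 : Multiset.card ({r, s, t} : Multiset (ZMod N)) = 3 := by simp
    rw [hM, Multiset.card_cons, hM', Multiset.card_cons] at h1
    omega
  obtain ⟨c, rfl⟩ := Multiset.card_eq_one.1 hcard
  have hsum : ({r, s, t} : Multiset (ZMod N)).sum = r + s + t := by
    simp only [Multiset.insert_eq_cons, Multiset.sum_cons, Multiset.sum_singleton]
    ring
  rw [hM, hM', Multiset.sum_cons, Multiset.sum_cons, Multiset.sum_singleton, h0] at hsum
  have hc : c = -a - b := by linear_combination hsum
  rw [hM, hM', hc]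
  rfl

omit hp in
/-- The image of a triple under multiplication by `w`. [folklore] -/
private theorem map_mul_triple₃ {N : ℕ} (w x y z : ZMod N) :
    (({x, y, z} : Multiset (ZMod N)).map (fun v => w * v)) = {w * x, w * y, w * z} := by
  simp only [Multiset.insert_eq_cons, Multiset.map_cons, Multiset.map_singleton]

/-- A prime power `pᵏ ≤ 5` with `p` odd and `k ≥ 1` is `3` or `5`. [folklore] -/
private theorem eq_one_and_of_pow_le_five (hp2 : p ≠ 2) {k : ℕ} (hk1 : 1 ≤ k) (h : p ^ k ≤ 5) : k = 1 ∧ (p = 3 ∨ p = 5) := by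
  have hp3 : 3 ≤ p := by
    have := hp.out.two_le
    omega
  have hple : p ≤ 5 := le_trans (Nat.le_self_pow (by omega) p) h
  have hk : k = 1 := by
    by_contra hk2
    have hk2' : 2 ≤ k := by omega
    have : p ^ 2 ≤ p ^ k := Nat.pow_le_pow_right hp.out.pos hk2'
    nlinarith
  refine ⟨hk, ?_⟩
  interval_cases p
  · exact Or.inl rfl
  · exact absurd hp.out (by norm_num)
  · exact Or.inr rfl

end Tools

/-! ## §2 The configuration "`τ` a unit triple, `τ′` with exactly one non-unit entry": the fibre of the non-unit entry lies
## inside `{r, s, t, −s′, −t′}` — impossible for `p ≥ 5`, and for `p = 3` it forces K–R's pair -/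

section OneNonUnit

variable {p : ℕ} [hp : Fact p.Prime] {n : ℕ}

/-- **The fibre of the non-unit entry is trapped**: if `τ = (r, s, t)` consists of units, `τ′ = (r′, s′, t′)` has `r′` a non-unit
(`≠ 0`) and `s′, t′` units, `r + s + t = 0 = r′ + s′ + t′` and `H_{τ′} = H_τ`, then every `y` with `p^{v(r′)}·y = r′` is one of
`r, s, t, −s′, −t′` (parity at `y`: the entry `r′` is counted at `y` but not at `−y`, since `r′ ≠ −r′`).
[cite: KoblitzRohrlich1978, §2 (p. 1188) and §3 Proposition (p. 1193)] -/
theorem mem_five_of_fibre (hp2 : p ≠ 2) (hn : n ≠ 0) {r s t r' s' t' : ZMod (p ^ n)}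
    (hr : IsUnit r) (hs : IsUnit s) (ht : IsUnit t) (hrst : r + s + t = 0)
    (hr'0 : r' ≠ 0) (hr'u : ¬IsUnit r') (hs' : IsUnit s') (ht' : IsUnit t') (hrst' : r' + s' + t' = 0)
    (heq : fermatCMType (p ^ n) r' s' t' = fermatCMType (p ^ n) r s t) {y : ZMod (p ^ n)}
    (hy : (p : ZMod (p ^ n)) ^ (r'.val.factorization p) * y = r') :
    y = r ∨ y = s ∨ y = t ∨ y = -s' ∨ y = -t' := by
  classical
  haveI : Fact (1 < p ^ n) := ⟨Nat.one_lt_pow hn hp.out.one_lt⟩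
  have hyu : IsUnit y := isUnit_of_pow_factorization_mul_eq hr'0 hy
  have hpar := countP_add_countP_eq_of_fermatCMType_eq hn hr.ne_zero hs.ne_zero ht.ne_zero hrst hr'0 hs'.ne_zero
    ht'.ne_zero hrst' heq hyu
  by_contra hcon
  push Not at hcon
  obtain ⟨h1, h2, h3, h4, h5⟩ := hcon
  have hA : ({r, s, t} : Multiset (ZMod (p ^ n))).countP
      (fun a => (p : ZMod (p ^ n)) ^ (a.val.factorization p) * y = a) = 0 := by
    refine Multiset.countP_eq_zero.2 fun a ha => ?_
    rcases (mem_triple_iff r s t a).1 ha with rfl | rfl | rfl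
    · rw [pow_factorization_mul_eq_iff_of_isUnit hn hr]; exact h1
    · rw [pow_factorization_mul_eq_iff_of_isUnit hn hs]; exact h2
    · rw [pow_factorization_mul_eq_iff_of_isUnit hn ht]; exact h3
  have hB : ({r', s', t'} : Multiset (ZMod (p ^ n))).countP
      (fun a => (p : ZMod (p ^ n)) ^ (a.val.factorization p) * -y = a) = 0 := by
    refine Multiset.countP_eq_zero.2 fun a ha => ?_
    rcases (mem_triple_iff r' s' t' a).1 ha with rfl | rfl | rfl
    · intro h
      rw [mul_neg, hy] at h
      exact ne_neg_of_ne_zero hp2 hr'0 h.symm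
    · rw [pow_factorization_mul_eq_iff_of_isUnit hn hs']
      intro h; exact h4 (by rw [← h, neg_neg])
    · rw [pow_factorization_mul_eq_iff_of_isUnit hn ht']
      intro h; exact h5 (by rw [← h, neg_neg])
  have hD : 0 < ({r', s', t'} : Multiset (ZMod (p ^ n))).countP
      (fun a => (p : ZMod (p ^ n)) ^ (a.val.factorization p) * y = a) :=
    Multiset.countP_pos.2 ⟨r', (mem_triple_iff r' s' t' r').2 (Or.inl rfl), hy⟩
  omega

/-- **Hence `p^{v(r′)} ≤ 5`, so `v(r′) = 1` and `p ∈ {3, 5}`; and `n ≥ 2`** (the fibre has `p^{v(r′)}` elements, all inside the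
five residues `r, s, t, −s′, −t′`). [cite: KoblitzRohrlich1978, §3 Proposition (p. 1193) and §4 Proposition (p. 1198)] -/
theorem factorization_eq_one_of_fibre (hp2 : p ≠ 2) (hn : n ≠ 0) {r s t r' s' t' : ZMod (p ^ n)}
    (hr : IsUnit r) (hs : IsUnit s) (ht : IsUnit t) (hrst : r + s + t = 0)
    (hr'0 : r' ≠ 0) (hr'u : ¬IsUnit r') (hs' : IsUnit s') (ht' : IsUnit t') (hrst' : r' + s' + t' = 0)
    (heq : fermatCMType (p ^ n) r' s' t' = fermatCMType (p ^ n) r s t) :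
    r'.val.factorization p = 1 ∧ (p = 3 ∨ p = 5) ∧ 2 ≤ n := by
  classical
  obtain ⟨hk, r₀, hr₀, er⟩ := exists_eq_pow_mul_unit_primePow hr'0
  have hk1 : 1 ≤ r'.val.factorization p := factorization_val_pos_of_not_isUnit hr'0 hr'u
  set k := r'.val.factorization p with hk_def
  -- the fibre as a finite set, of cardinality `pᵏ`, inside the five residues
  set C := Finset.univ.filter (fun x : ZMod (p ^ n) => (p : ZMod (p ^ n)) ^ k * x = (p : ZMod (p ^ n)) ^ k * r₀) with hC
  have hsub : C ⊆ ({r, s, t, -s', -t'} : Finset (ZMod (p ^ n))) := by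
    intro y hy
    have hy' : (p : ZMod (p ^ n)) ^ k * y = r' := by rw [er]; exact (Finset.mem_filter.1 hy).2
    simp only [Finset.mem_insert, Finset.mem_singleton]
    exact mem_five_of_fibre hp2 hn hr hs ht hrst hr'0 hr'u hs' ht' hrst' heq hy'
  have h5 : ({r, s, t, -s', -t'} : Finset (ZMod (p ^ n))).card ≤ 5 := by
    refine (Finset.card_insert_le _ _).trans ?_
    refine (Nat.add_le_add_right (Finset.card_insert_le _ _) 1).trans ?_
    refine (Nat.add_le_add_right (Nat.add_le_add_right (Finset.card_insert_le _ _) 1) 1).trans ?_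
    refine (Nat.add_le_add_right (Nat.add_le_add_right (Nat.add_le_add_right (Finset.card_insert_le _ _) 1) 1) 1).trans ?_
    rw [Finset.card_singleton]
  have hcard : p ^ k ≤ 5 := by
    rw [← card_filter_pow_mul hk r₀]
    exact (Finset.card_le_card hsub).trans h5
  obtain ⟨hk1', hp35⟩ := eq_one_and_of_pow_le_five hp2 hk1 hcard
  exact ⟨hk1', hp35, by omega⟩

/-- **At `p ≥ 7` (indeed `p ≠ 3, 5`) the configuration is impossible.** [cite: KoblitzRohrlich1978, §3 Proposition (p. 1193)] -/
theorem false_of_fibre_of_seven_le (hp2 : p ≠ 2) (hp3 : p ≠ 3) (hp5 : p ≠ 5) (hn : n ≠ 0) {r s t r' s' t' : ZMod (p ^ n)}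
    (hr : IsUnit r) (hs : IsUnit s) (ht : IsUnit t) (hrst : r + s + t = 0)
    (hr'0 : r' ≠ 0) (hr'u : ¬IsUnit r') (hs' : IsUnit s') (ht' : IsUnit t') (hrst' : r' + s' + t' = 0)
    (heq : fermatCMType (p ^ n) r' s' t' = fermatCMType (p ^ n) r s t) : False := by
  obtain ⟨-, h35, -⟩ := factorization_eq_one_of_fibre hp2 hn hr hs ht hrst hr'0 hr'u hs' ht' hrst' heq
  rcases h35 with h | h
  · exact hp3 h
  · exact hp5 h

/-- **At `p = 5` the configuration is impossible**: the fibre `{y : 5y = r′}` would BE `{r, s, t, −s′, −t′}`, so `−s′ ≡ −t′ ≡ r′/5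
(mod 5)`; but `s′ + t′ = −r′ ≡ 0 (mod 5)` with `s′` a unit forces `s′ ≢ t′`. [cite: KoblitzRohrlich1978, §3 Proposition (p. 1193)] -/
theorem false_of_fibre_five (hn : n ≠ 0) {r s t r' s' t' : ZMod (5 ^ n)}
    (hr : IsUnit r) (hs : IsUnit s) (ht : IsUnit t) (hrst : r + s + t = 0)
    (hr'0 : r' ≠ 0) (hr'u : ¬IsUnit r') (hs' : IsUnit s') (ht' : IsUnit t') (hrst' : r' + s' + t' = 0)
    (heq : fermatCMType (5 ^ n) r' s' t' = fermatCMType (5 ^ n) r s t) : False := by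
  classical
  haveI : Fact (Nat.Prime 5) := ⟨by norm_num⟩
  obtain ⟨hk1, -, hn2⟩ := factorization_eq_one_of_fibre (p := 5) (by norm_num) hn hr hs ht hrst hr'0 hr'u hs' ht' hrst' heq
  obtain ⟨hk, r₀, hr₀, er⟩ := exists_eq_pow_mul_unit_primePow hr'0
  rw [hk1] at hk er
  set C := Finset.univ.filter (fun x : ZMod (5 ^ n) => ((5 : ℕ) : ZMod (5 ^ n)) ^ 1 * x = ((5 : ℕ) : ZMod (5 ^ n)) ^ 1 * r₀)
    with hC
  have hsub : C ⊆ ({r, s, t, -s', -t'} : Finset (ZMod (5 ^ n))) := by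
    intro y hy
    have hy' : ((5 : ℕ) : ZMod (5 ^ n)) ^ (r'.val.factorization 5) * y = r' := by
      rw [hk1, er]; exact (Finset.mem_filter.1 hy).2
    simp only [Finset.mem_insert, Finset.mem_singleton]
    exact mem_five_of_fibre (p := 5) (by norm_num) hn hr hs ht hrst hr'0 hr'u hs' ht' hrst' heq hy'
  have h5 : ({r, s, t, -s', -t'} : Finset (ZMod (5 ^ n))).card ≤ 5 := by
    refine (Finset.card_insert_le _ _).trans ?_
    refine (Nat.add_le_add_right (Finset.card_insert_le _ _) 1).trans ?_
    refine (Nat.add_le_add_right (Nat.add_le_add_right (Finset.card_insert_le _ _) 1) 1).trans ?_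
    refine (Nat.add_le_add_right (Nat.add_le_add_right (Nat.add_le_add_right (Finset.card_insert_le _ _) 1) 1) 1).trans ?_
    rw [Finset.card_singleton]
  have hCcard : C.card = 5 := by rw [hC, card_filter_pow_mul hk r₀, pow_one]
  have hCeq : C = ({r, s, t, -s', -t'} : Finset (ZMod (5 ^ n))) :=
    Finset.eq_of_subset_of_card_le hsub (by rw [hCcard]; exact h5)
  have hms : -s' ∈ C := by rw [hCeq]; simp
  have hmt : -t' ∈ C := by rw [hCeq]; simp
  have es := castHom_eq_of_pow_mul_eq (p := 5) hn hk (Finset.mem_filter.1 hms).2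
  have et := castHom_eq_of_pow_mul_eq (p := 5) hn hk (Finset.mem_filter.1 hmt).2
  have hne : ZMod.castHom (dvd_pow_self 5 hn) (ZMod 5) s' ≠ ZMod.castHom (dvd_pow_self 5 hn) (ZMod 5) t' := by
    refine castHom_ne_of_add_not_isUnit (p := 5) (by norm_num) hn hs' ?_
    rw [show s' + t' = -r' by linear_combination hrst', IsUnit.neg_iff]
    exact hr'u
  apply hne
  have h := es.trans et.symm
  rw [map_neg, map_neg, neg_inj] at h
  exact h

end OneNonUnit

/-! ## §3 Invariance of the non-unit counts under `1 + pⁿ⁻¹ℤ`, and the configurations with an all-non-unit triple -/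

section NonUnitTriple

variable {p : ℕ} [hp : Fact p.Prime] {n : ℕ}

/-- **The count of NON-UNIT entries is invariant under `y ↦ g·y` for `g·p = p`** (each non-unit entry's fibre is a union of
cosets of `1 + pⁿ⁻¹ℤ/pⁿℤ`; K–R: "`⟨ur⟩ = r`, `⟨us⟩ = s`, `⟨ut⟩ = t` for `u ∈ P`"). [cite: KoblitzRohrlich1978, §3 Case 1 (p. 1193)] -/
theorem countP_mul_eq_of_forall_not_isUnit {T : Multiset (ZMod (p ^ n))} (hT : ∀ a ∈ T, a ≠ 0 ∧ ¬IsUnit a)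
    {g : ZMod (p ^ n)} (hg : g * (p : ZMod (p ^ n)) = p) (y : ZMod (p ^ n)) :
    T.countP (fun a => (p : ZMod (p ^ n)) ^ (a.val.factorization p) * (g * y) = a) =
      T.countP (fun a => (p : ZMod (p ^ n)) ^ (a.val.factorization p) * y = a) :=
  Multiset.countP_congr rfl fun a ha => propext (pow_factorization_mul_mul_eq_iff (hT a ha).1 (hT a ha).2 hg y)

/-- **For a triple of UNITS the count at `y` is positive iff `y` is one of the entries.**
[cite: KoblitzRohrlich1978, §2 (p. 1187, the relatively prime case)] -/
theorem countP_pos_iff_of_isUnit (hn : n ≠ 0) {r s t : ZMod (p ^ n)} (hr : IsUnit r) (hs : IsUnit s) (ht : IsUnit t)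
    (y : ZMod (p ^ n)) :
    0 < ({r, s, t} : Multiset (ZMod (p ^ n))).countP (fun a => (p : ZMod (p ^ n)) ^ (a.val.factorization p) * y = a) ↔
      (y = r ∨ y = s ∨ y = t) := by
  classical
  rw [Multiset.countP_pos]
  constructor
  · rintro ⟨a, ha, hya⟩
    rcases (mem_triple_iff r s t a).1 ha with rfl | rfl | rfl
    · exact Or.inl ((pow_factorization_mul_eq_iff_of_isUnit hn hr y).1 hya)
    · exact Or.inr (Or.inl ((pow_factorization_mul_eq_iff_of_isUnit hn hs y).1 hya))
    · exact Or.inr (Or.inr ((pow_factorization_mul_eq_iff_of_isUnit hn ht y).1 hya))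
  · rintro (rfl | rfl | rfl)
    · exact ⟨y, (mem_triple_iff y s t y).2 (Or.inl rfl), (pow_factorization_mul_eq_iff_of_isUnit hn hr y).2 rfl⟩
    · exact ⟨y, (mem_triple_iff r y t y).2 (Or.inr (Or.inl rfl)), (pow_factorization_mul_eq_iff_of_isUnit hn hs y).2 rfl⟩
    · exact ⟨y, (mem_triple_iff r s y y).2 (Or.inr (Or.inr rfl)), (pow_factorization_mul_eq_iff_of_isUnit hn ht y).2 rfl⟩

/-- The negatives of the entries of a unit triple with sum `0` are not entries (`−r = s` would force `t = 0`; `p` odd).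
[cite: KoblitzRohrlich1978, §2 (p. 1188, "since `⟨r′⟩ + ⟨−r′⟩ = N`")] -/
theorem countP_neg_eq_zero_of_isUnit (hp2 : p ≠ 2) (hn : n ≠ 0) {r s t : ZMod (p ^ n)} (hr : IsUnit r) (hs : IsUnit s)
    (ht : IsUnit t) (hrst : r + s + t = 0) :
    ({r, s, t} : Multiset (ZMod (p ^ n))).countP (fun a => (p : ZMod (p ^ n)) ^ (a.val.factorization p) * -r = a) = 0 := by
  classical
  haveI : Fact (1 < p ^ n) := ⟨Nat.one_lt_pow hn hp.out.one_lt⟩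
  refine Multiset.countP_eq_zero.2 fun a ha => ?_
  rcases (mem_triple_iff r s t a).1 ha with rfl | rfl | rfl
  · rw [pow_factorization_mul_eq_iff_of_isUnit hn hr]
    exact fun h => ne_neg_of_ne_zero hp2 hr.ne_zero h.symm
  · rw [pow_factorization_mul_eq_iff_of_isUnit hn hs]
    intro h
    exact ht.ne_zero (by linear_combination hrst + h)
  · rw [pow_factorization_mul_eq_iff_of_isUnit hn ht]
    intro h
    exact hs.ne_zero (by linear_combination hrst + h)

/-- A non-unit non-zero residue exists only for `n ≥ 2`. [cite: KoblitzRohrlich1978, §4 proof of the Proposition (p. 1198, "`ord`")] -/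
theorem two_le_of_not_isUnit {a : ZMod (p ^ n)} (ha : a ≠ 0) (hau : ¬IsUnit a) : 2 ≤ n := by
  have h1 := (exists_eq_pow_mul_unit_primePow ha).1
  have h2 := factorization_val_pos_of_not_isUnit ha hau
  omega

/-- `3 ≠ 0` modulo `pⁿ` for `n ≥ 2`. [folklore] -/
private theorem three_ne_zero (hn : 2 ≤ n) : (3 : ZMod (p ^ n)) ≠ 0 := by
  have h3 : ((3 : ℕ) : ZMod (p ^ n)) = 3 := by norm_num
  rw [← h3, Ne, ZMod.natCast_eq_zero_iff]
  intro h
  have h4 : 4 ≤ p ^ n := by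
    calc 4 = 2 ^ 2 := by norm_num
      _ ≤ p ^ 2 := Nat.pow_le_pow_left hp.out.two_le 2
      _ ≤ p ^ n := Nat.pow_le_pow_right hp.out.pos hn
  exact absurd (Nat.le_of_dvd (by norm_num) h) (by omega)

/-- **A unit triple never shares its Fermat set with a triple of NON-UNITS** (prime-power level `pⁿ`, `p` odd): if `r, s, t` are
units, `r′, s′, t′ ≠ 0` are non-units, both sums vanish and `H_{τ′} = H_τ`, contradiction.  (Parity at `r` and at `g·r`,
`g = 1 + m pⁿ⁻¹`: the `τ′`-counts do not see `g`, so `g·r ∈ {r, s, t}` for `m = 1, 2`; then `{s, t} = {g₁r, g₂r}` and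
`r + s + t = 3g₁·r ≠ 0`.)  K–R's §3 Case 1 ("g.c.d.`(r, s, t, N) > 1`") and §4 Case 1 ("`ord s > 0`").
[cite: KoblitzRohrlich1978, §3 Case 1 (pp. 1193–1194) and §4 Case 1 (p. 1198)] -/
theorem false_of_units_of_nonunits (hp2 : p ≠ 2) (hn : n ≠ 0) {r s t r' s' t' : ZMod (p ^ n)}
    (hr : IsUnit r) (hs : IsUnit s) (ht : IsUnit t) (hrst : r + s + t = 0)
    (hr'0 : r' ≠ 0) (hs'0 : s' ≠ 0) (ht'0 : t' ≠ 0) (hr'u : ¬IsUnit r') (hs'u : ¬IsUnit s') (ht'u : ¬IsUnit t')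
    (hrst' : r' + s' + t' = 0) (heq : fermatCMType (p ^ n) r' s' t' = fermatCMType (p ^ n) r s t) : False := by
  classical
  haveI : Fact (1 < p ^ n) := ⟨Nat.one_lt_pow hn hp.out.one_lt⟩
  have hn2 : 2 ≤ n := two_le_of_not_isUnit hr'0 hr'u
  have hT : ∀ a ∈ ({r', s', t'} : Multiset (ZMod (p ^ n))), a ≠ 0 ∧ ¬IsUnit a := by
    intro a ha
    rcases (mem_triple_iff r' s' t' a).1 ha with rfl | rfl | rfl
    exacts [⟨hr'0, hr'u⟩, ⟨hs'0, hs'u⟩, ⟨ht'0, ht'u⟩]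
  -- the elements `g_m = 1 + m pⁿ⁻¹`
  set g : ℕ → ZMod (p ^ n) := fun m => 1 + (m : ZMod (p ^ n)) * (p : ZMod (p ^ n)) ^ (n - 1) with hg
  have hgp : ∀ m, g m * (p : ZMod (p ^ n)) = p := fun m => one_add_mul_pow_mul_p hn _
  have hgu : ∀ m, IsUnit (g m) := fun m => isUnit_one_add_mul_pow hn2 _
  -- parity at `r` and at `g_m r`: `g_m r ∈ {r, s, t}`
  have hpar0 := countP_add_countP_eq_of_fermatCMType_eq hn hr.ne_zero hs.ne_zero ht.ne_zero hrst hr'0 hs'0 ht'0 hrst'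
    heq hr
  have hC0 := countP_neg_eq_zero_of_isUnit hp2 hn hr hs ht hrst
  have hA0 : 0 < ({r, s, t} : Multiset (ZMod (p ^ n))).countP
      (fun a => (p : ZMod (p ^ n)) ^ (a.val.factorization p) * r = a) :=
    (countP_pos_iff_of_isUnit hn hr hs ht r).2 (Or.inl rfl)
  have hmem : ∀ m, g m * r = r ∨ g m * r = s ∨ g m * r = t := by
    intro m
    have hparm := countP_add_countP_eq_of_fermatCMType_eq hn hr.ne_zero hs.ne_zero ht.ne_zero hrst hr'0 hs'0 ht'0 hrst'
      heq ((hgu m).mul hr)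
    rw [show -(g m * r) = g m * -r by ring, countP_mul_eq_of_forall_not_isUnit hT (hgp m),
      countP_mul_eq_of_forall_not_isUnit hT (hgp m)] at hparm
    refine (countP_pos_iff_of_isUnit hn hr hs ht (g m * r)).1 ?_
    omega
  have hinj : ∀ {i j : ℕ}, i < p → j < p → g i * r = g j * r → i = j := by
    intro i j hi hj h
    rw [mul_comm (g i), mul_comm (g j)] at h
    exact mul_one_add_mul_pow_injective hn hr hi hj h
  have hp3 : 3 ≤ p := by have := hp.out.two_le; omega
  have hg0 : g 0 * r = r := by rw [hg]; simp
  have h1 : g 1 * r = s ∨ g 1 * r = t := by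
    rcases hmem 1 with h | h | h
    · exact absurd (hinj (by omega) (by omega) (h.trans hg0.symm)) (by norm_num)
    · exact Or.inl h
    · exact Or.inr h
  have h2 : g 2 * r = s ∨ g 2 * r = t := by
    rcases hmem 2 with h | h | h
    · exact absurd (hinj (by omega) (by omega) (h.trans hg0.symm)) (by norm_num)
    · exact Or.inl h
    · exact Or.inr h
  have h12 : g 1 * r ≠ g 2 * r := fun h => absurd (hinj (by omega) (by omega) h) (by norm_num)
  -- so `{s, t} = {g₁ r, g₂ r}` and `r + s + t = (1 + g₁ + g₂) r = 3 g₁ r ≠ 0`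
  have hsum : s + t = (g 1 + g 2) * r := by
    rcases h1 with h1 | h1 <;> rcases h2 with h2 | h2
    · exact absurd (h1.trans h2.symm) h12
    · rw [← h1, ← h2]; ring
    · rw [← h1, ← h2]; ring
    · exact absurd (h1.trans h2.symm) h12
  have hkey : (3 : ZMod (p ^ n)) * (g 1 * r) = 0 := by
    have e : (1 : ZMod (p ^ n)) + g 1 + g 2 = 3 * g 1 := by rw [hg]; push_cast; ring
    calc (3 : ZMod (p ^ n)) * (g 1 * r) = (3 * g 1) * r := by ring
      _ = (1 + g 1 + g 2) * r := by rw [e]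
      _ = r + (s + t) := by rw [hsum]; ring
      _ = 0 := by rw [← add_assoc, hrst]
  exact three_ne_zero hn2 (((hgu 1).mul hr).mul_left_eq_zero.1 hkey)

/-- **A triple with exactly one non-unit never shares its Fermat set with a triple of NON-UNITS**: `r ≠ 0` a non-unit, `s, t` units,
`r′, s′, t′ ≠ 0` non-units, sums `0`, `H_{τ′} = H_τ` is contradictory (parity at `s` and `g₁s`: `g₁s ∈ {s, t}`, but `g₁s ≠ s` and
`g₁s ≡ s ≢ t (mod p)`).  K–R §4 Case 1. [cite: KoblitzRohrlich1978, §4 proof of the Proposition, Case 1 (p. 1198)] -/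
theorem false_of_one_nonunit_of_nonunits (hp2 : p ≠ 2) (hn : n ≠ 0) {r s t r' s' t' : ZMod (p ^ n)}
    (hr0 : r ≠ 0) (hru : ¬IsUnit r) (hs : IsUnit s) (ht : IsUnit t) (hrst : r + s + t = 0)
    (hr'0 : r' ≠ 0) (hs'0 : s' ≠ 0) (ht'0 : t' ≠ 0) (hr'u : ¬IsUnit r') (hs'u : ¬IsUnit s') (ht'u : ¬IsUnit t')
    (hrst' : r' + s' + t' = 0) (heq : fermatCMType (p ^ n) r' s' t' = fermatCMType (p ^ n) r s t) : False := by
  classical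
  haveI : Fact (1 < p ^ n) := ⟨Nat.one_lt_pow hn hp.out.one_lt⟩
  have hn2 : 2 ≤ n := two_le_of_not_isUnit hr'0 hr'u
  have hT : ∀ a ∈ ({r', s', t'} : Multiset (ZMod (p ^ n))), a ≠ 0 ∧ ¬IsUnit a := by
    intro a ha
    rcases (mem_triple_iff r' s' t' a).1 ha with rfl | rfl | rfl
    exacts [⟨hr'0, hr'u⟩, ⟨hs'0, hs'u⟩, ⟨ht'0, ht'u⟩]
  set g : ZMod (p ^ n) := 1 + (1 : ZMod (p ^ n)) * (p : ZMod (p ^ n)) ^ (n - 1) with hg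
  have hgp : g * (p : ZMod (p ^ n)) = p := one_add_mul_pow_mul_p hn _
  have hgu : IsUnit g := isUnit_one_add_mul_pow hn2 _
  -- split the `τ`-counts into the `r`-part (invariant) and the `{s, t}`-part
  have split : ∀ y : ZMod (p ^ n), ({r, s, t} : Multiset (ZMod (p ^ n))).countP
      (fun a => (p : ZMod (p ^ n)) ^ (a.val.factorization p) * y = a) =
      ({s, t} : Multiset (ZMod (p ^ n))).countP (fun a => (p : ZMod (p ^ n)) ^ (a.val.factorization p) * y = a) +
        (if (p : ZMod (p ^ n)) ^ (r.val.factorization p) * y = r then 1 else 0) := fun y => by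
    rw [Multiset.insert_eq_cons, Multiset.countP_cons]
  have hpar0 := countP_add_countP_eq_of_fermatCMType_eq hn hr0 hs.ne_zero ht.ne_zero hrst hr'0 hs'0 ht'0 hrst' heq hs
  have hpar1 := countP_add_countP_eq_of_fermatCMType_eq hn hr0 hs.ne_zero ht.ne_zero hrst hr'0 hs'0 ht'0 hrst' heq (hgu.mul hs)
  rw [split, split] at hpar0 hpar1
  rw [show -(g * s) = g * -s by ring] at hpar1
  simp only [countP_mul_eq_of_forall_not_isUnit hT hgp, pow_factorization_mul_mul_eq_iff hr0 hru hgp] at hpar1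
  -- the `{s,t}`-counts at `s` and `−s`
  have hmem2 : ∀ a ∈ ({s, t} : Multiset (ZMod (p ^ n))), a = s ∨ a = t := fun a ha => by
    simpa only [Multiset.insert_eq_cons, Multiset.mem_cons, Multiset.mem_singleton] using ha
  have hA0 : 0 < ({s, t} : Multiset (ZMod (p ^ n))).countP (fun a => (p : ZMod (p ^ n)) ^ (a.val.factorization p) * s = a) :=
    Multiset.countP_pos.2 ⟨s, Multiset.mem_cons_self _ _, (pow_factorization_mul_eq_iff_of_isUnit hn hs s).2 rfl⟩
  have hC0 : ({s, t} : Multiset (ZMod (p ^ n))).countP (fun a => (p : ZMod (p ^ n)) ^ (a.val.factorization p) * -s = a) = 0 := by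
    refine Multiset.countP_eq_zero.2 fun a ha => ?_
    rcases hmem2 a ha with rfl | rfl
    · rw [pow_factorization_mul_eq_iff_of_isUnit hn hs]
      exact fun h => ne_neg_of_ne_zero hp2 hs.ne_zero h.symm
    · rw [pow_factorization_mul_eq_iff_of_isUnit hn ht]
      intro h
      exact hr0 (by linear_combination hrst + h)
  have hA1 : 0 < ({s, t} : Multiset (ZMod (p ^ n))).countP
      (fun a => (p : ZMod (p ^ n)) ^ (a.val.factorization p) * (g * s) = a) := by
    omega
  obtain ⟨a, ha, hga⟩ := Multiset.countP_pos.1 hA1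
  have hψ : ZMod.castHom (dvd_pow_self p hn) (ZMod p) (g * s) = ZMod.castHom (dvd_pow_self p hn) (ZMod p) s := by
    rw [map_mul, hg, castHom_one_add_mul_pow hn2, one_mul]
  rcases hmem2 a ha with rfl | rfl
  · rw [pow_factorization_mul_eq_iff_of_isUnit hn hs] at hga
    have h := mul_one_add_mul_pow_injective hn hs (by have := hp.out.two_le; omega) hp.out.pos
      (show a * (1 + ((1 : ℕ) : ZMod (p ^ n)) * (p : ZMod (p ^ n)) ^ (n - 1)) =
        a * (1 + ((0 : ℕ) : ZMod (p ^ n)) * (p : ZMod (p ^ n)) ^ (n - 1)) by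
        rw [Nat.cast_one, Nat.cast_zero, zero_mul, add_zero, mul_one, mul_comm]; exact hga)
    exact one_ne_zero h
  · rw [pow_factorization_mul_eq_iff_of_isUnit hn ht] at hga
    rw [hga] at hψ
    refine castHom_ne_of_add_not_isUnit hp2 hn hs ?_ hψ.symm
    rw [show s + a = -r by linear_combination hrst, IsUnit.neg_iff]
    exact hru

end NonUnitTriple

/-! ## §4 Both triples with exactly one non-unit entry: `H_τ = H_{τ′}` forces `{τ′} = {τ}` -/

section TwoMixed

variable {p : ℕ} [hp : Fact p.Prime] {n : ℕ}

/-- For a PAIR of units the count at `y` is positive iff `y` is one of them. [cite: KoblitzRohrlich1978, §2 (p. 1187)] -/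
theorem countP_pair_pos_iff (hn : n ≠ 0) {s t : ZMod (p ^ n)} (hs : IsUnit s) (ht : IsUnit t) (y : ZMod (p ^ n)) :
    0 < ({s, t} : Multiset (ZMod (p ^ n))).countP (fun a => (p : ZMod (p ^ n)) ^ (a.val.factorization p) * y = a) ↔
      (y = s ∨ y = t) := by
  classical
  rw [Multiset.countP_pos]
  have hmem : ∀ a, a ∈ ({s, t} : Multiset (ZMod (p ^ n))) ↔ a = s ∨ a = t := fun a => by
    simp only [Multiset.insert_eq_cons, Multiset.mem_cons, Multiset.mem_singleton]
  constructor
  · rintro ⟨a, ha, hya⟩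
    rcases (hmem a).1 ha with rfl | rfl
    · exact Or.inl ((pow_factorization_mul_eq_iff_of_isUnit hn hs y).1 hya)
    · exact Or.inr ((pow_factorization_mul_eq_iff_of_isUnit hn ht y).1 hya)
  · rintro (rfl | rfl)
    · exact ⟨y, (hmem y).2 (Or.inl rfl), (pow_factorization_mul_eq_iff_of_isUnit hn hs y).2 rfl⟩
    · exact ⟨y, (hmem y).2 (Or.inr rfl), (pow_factorization_mul_eq_iff_of_isUnit hn ht y).2 rfl⟩

/-- **One non-unit on each side: the unit entry `s` of `τ` occurs in `τ′`.**  Let `τ = (r, s, t)`, `τ′ = (r′, s′, t′)` with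
`r, r′ ≠ 0` non-units, `s, t, s′, t′` units, sums `0`, and `H_{τ′} = H_τ`.  Then `s ∈ {s′, t′}`.  (Otherwise parity at `s`, `g₁s`,
`g₂s` — the non-unit counts do not see `g_m = 1 + m pⁿ⁻¹` — puts `−g₁s, −g₂s` both in `{s′, t′}`, two distinct residues `≡ −s
(mod p)`, while `s′ ≢ t′ (mod p)`.)  K–R §4 Cases 2–3 / §3 Cases 2–3 reach "`τ′` is a permutation of `τ`" here by estimating
(6), (9), (12). [cite: KoblitzRohrlich1978, §4 proof of the Proposition, Cases 2–3 (pp. 1198–1199); §3 Cases 2–3 (pp. 1195–1197)] -/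
theorem eq_or_eq_of_one_nonunit (hp2 : p ≠ 2) (hn : n ≠ 0) {r s t r' s' t' : ZMod (p ^ n)}
    (hr0 : r ≠ 0) (hru : ¬IsUnit r) (hs : IsUnit s) (ht : IsUnit t) (hrst : r + s + t = 0)
    (hr'0 : r' ≠ 0) (hr'u : ¬IsUnit r') (hs' : IsUnit s') (ht' : IsUnit t') (hrst' : r' + s' + t' = 0)
    (heq : fermatCMType (p ^ n) r' s' t' = fermatCMType (p ^ n) r s t) : s = s' ∨ s = t' := by
  classical
  haveI : Fact (1 < p ^ n) := ⟨Nat.one_lt_pow hn hp.out.one_lt⟩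
  have hn2 : 2 ≤ n := two_le_of_not_isUnit hr0 hru
  by_contra hcon
  push Not at hcon
  obtain ⟨hss', hst'⟩ := hcon
  set g : ℕ → ZMod (p ^ n) := fun m => 1 + (m : ZMod (p ^ n)) * (p : ZMod (p ^ n)) ^ (n - 1) with hg
  have hgp : ∀ m, g m * (p : ZMod (p ^ n)) = p := fun m => one_add_mul_pow_mul_p hn _
  have hgu : ∀ m, IsUnit (g m) := fun m => isUnit_one_add_mul_pow hn2 _
  have hψg : ∀ m (y : ZMod (p ^ n)), ZMod.castHom (dvd_pow_self p hn) (ZMod p) (g m * y) =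
      ZMod.castHom (dvd_pow_self p hn) (ZMod p) y := fun m y => by
    rw [map_mul, hg, castHom_one_add_mul_pow hn2, one_mul]
  have split : ∀ (a b c y : ZMod (p ^ n)), ({a, b, c} : Multiset (ZMod (p ^ n))).countP
      (fun x => (p : ZMod (p ^ n)) ^ (x.val.factorization p) * y = x) =
      ({b, c} : Multiset (ZMod (p ^ n))).countP (fun x => (p : ZMod (p ^ n)) ^ (x.val.factorization p) * y = x) +
        (if (p : ZMod (p ^ n)) ^ (a.val.factorization p) * y = a then 1 else 0) := fun a b c y => by
    rw [Multiset.insert_eq_cons, Multiset.countP_cons]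
  -- parity at `s`
  have hpar0 := countP_add_countP_eq_of_fermatCMType_eq hn hr0 hs.ne_zero ht.ne_zero hrst hr'0 hs'.ne_zero ht'.ne_zero hrst' heq hs
  rw [split, split, split, split] at hpar0
  have hUs : 0 < ({s, t} : Multiset (ZMod (p ^ n))).countP (fun a => (p : ZMod (p ^ n)) ^ (a.val.factorization p) * s = a) :=
    (countP_pair_pos_iff hn hs ht s).2 (Or.inl rfl)
  have hUns : ({s, t} : Multiset (ZMod (p ^ n))).countP (fun a => (p : ZMod (p ^ n)) ^ (a.val.factorization p) * -s = a) = 0 := by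
    refine Nat.eq_zero_of_not_pos fun h => ?_
    rcases (countP_pair_pos_iff hn hs ht (-s)).1 h with h | h
    · exact ne_neg_of_ne_zero hp2 hs.ne_zero h.symm
    · exact hr0 (by linear_combination hrst + h)
  have hU's : ({s', t'} : Multiset (ZMod (p ^ n))).countP (fun a => (p : ZMod (p ^ n)) ^ (a.val.factorization p) * s = a) = 0 := by
    refine Nat.eq_zero_of_not_pos fun h => ?_
    rcases (countP_pair_pos_iff hn hs' ht' s).1 h with h | h
    · exact hss' h
    · exact hst' h
  -- parity at `g_m s`: `−g_m s ∈ {s′, t′}`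
  have hmem : ∀ m, 0 < m → m < p → g m * -s = s' ∨ g m * -s = t' := by
    intro m hm0 hmp
    have hparm := countP_add_countP_eq_of_fermatCMType_eq hn hr0 hs.ne_zero ht.ne_zero hrst hr'0 hs'.ne_zero ht'.ne_zero hrst'
      heq ((hgu m).mul hs)
    rw [split, split, split, split, show -(g m * s) = g m * -s by ring] at hparm
    simp only [pow_factorization_mul_mul_eq_iff hr0 hru (hgp m), pow_factorization_mul_mul_eq_iff hr'0 hr'u (hgp m)] at hparm
    have hsum : 0 < ({s, t} : Multiset (ZMod (p ^ n))).countP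
        (fun a => (p : ZMod (p ^ n)) ^ (a.val.factorization p) * (g m * s) = a) +
        ({s', t'} : Multiset (ZMod (p ^ n))).countP
          (fun a => (p : ZMod (p ^ n)) ^ (a.val.factorization p) * (g m * -s) = a) := by
      omega
    rcases Nat.add_pos_iff_pos_or_pos.1 hsum with h | h
    · exfalso
      rcases (countP_pair_pos_iff hn hs ht _).1 h with h | h
      · have := mul_one_add_mul_pow_injective hn hs hmp hp.out.pos
          (show s * (1 + ((m : ℕ) : ZMod (p ^ n)) * (p : ZMod (p ^ n)) ^ (n - 1)) =
            s * (1 + ((0 : ℕ) : ZMod (p ^ n)) * (p : ZMod (p ^ n)) ^ (n - 1)) by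
            rw [Nat.cast_zero, zero_mul, add_zero, mul_one, mul_comm]; exact h)
        omega
      · refine castHom_ne_of_add_not_isUnit hp2 hn hs ?_ ((hψg m s).symm.trans (by rw [h]))
        rw [show s + t = -r by linear_combination hrst, IsUnit.neg_iff]
        exact hru
    · exact (countP_pair_pos_iff hn hs' ht' _).1 h
  have hp3 : 3 ≤ p := by have := hp.out.two_le; omega
  have hne : ZMod.castHom (dvd_pow_self p hn) (ZMod p) s' ≠ ZMod.castHom (dvd_pow_self p hn) (ZMod p) t' := by
    refine castHom_ne_of_add_not_isUnit hp2 hn hs' ?_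
    rw [show s' + t' = -r' by linear_combination hrst', IsUnit.neg_iff]
    exact hr'u
  have h12 : g 1 * -s ≠ g 2 * -s := by
    intro h
    rw [mul_comm (g 1), mul_comm (g 2)] at h
    have := mul_one_add_mul_pow_injective hn hs.neg (by omega) (by omega) h
    norm_num at this
  rcases hmem 1 one_pos (by omega) with h1 | h1 <;> rcases hmem 2 two_pos (by omega) with h2 | h2
  · exact h12 (h1.trans h2.symm)
  · exact hne (by rw [← h1, ← h2, hψg, hψg])
  · exact hne (by rw [← h1, ← h2, hψg, hψg])
  · exact h12 (h1.trans h2.symm)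

/-- Triples as multisets: the transposition of the last two entries. [folklore] -/
private theorem triple_swap₂₃ {N : ℕ} (a b c : ZMod N) : ({a, b, c} : Multiset (ZMod N)) = {a, c, b} := by
  rw [Multiset.pair_comm b c]

/-- Triples as multisets: the transposition of the first two entries. [folklore] -/
private theorem triple_swap₁₂ {N : ℕ} (a b c : ZMod N) : ({a, b, c} : Multiset (ZMod N)) = {b, a, c} := by
  rw [Multiset.insert_eq_cons, Multiset.insert_eq_cons, Multiset.insert_eq_cons, Multiset.insert_eq_cons, Multiset.cons_swap]

/-- **BOTH TRIPLES WITH EXACTLY ONE NON-UNIT: `H_{τ′} = H_τ` forces `{τ′} = {τ}`** (prime-power level `pⁿ`, `p` odd; `r, r′ ≠ 0`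
non-units, the other four entries units, sums `0`).  By the previous theorem and its three mirror images `s, t ∈ {s′, t′}` and
`s′, t′ ∈ {s, t}`, whence `{s, t} = {s′, t′}` and `r = r′`.  K–R reach this ("`τ′` is a permutation of `τ`") in §4 Cases 2–3 and
§3 Cases 2–3. [cite: KoblitzRohrlich1978, §4 Proposition, Cases 2–3 (pp. 1198–1199); §3 Proposition, Cases 2–3 (pp. 1195–1197)] -/
theorem multiset_eq_of_one_nonunit (hp2 : p ≠ 2) (hn : n ≠ 0) {r s t r' s' t' : ZMod (p ^ n)}
    (hr0 : r ≠ 0) (hru : ¬IsUnit r) (hs : IsUnit s) (ht : IsUnit t) (hrst : r + s + t = 0)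
    (hr'0 : r' ≠ 0) (hr'u : ¬IsUnit r') (hs' : IsUnit s') (ht' : IsUnit t') (hrst' : r' + s' + t' = 0)
    (heq : fermatCMType (p ^ n) r' s' t' = fermatCMType (p ^ n) r s t) :
    ({r', s', t'} : Multiset (ZMod (p ^ n))) = {r, s, t} := by
  have h1 := eq_or_eq_of_one_nonunit hp2 hn hr0 hru hs ht hrst hr'0 hr'u hs' ht' hrst' heq
  have h2 := eq_or_eq_of_one_nonunit hp2 hn hr0 hru ht hs (by linear_combination hrst) hr'0 hr'u hs' ht' hrst'
    (heq.trans (fermatCMType_eq_of_multiset_eq (triple_swap₂₃ r s t)))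
  have h3 := eq_or_eq_of_one_nonunit hp2 hn hr'0 hr'u hs' ht' hrst' hr0 hru hs ht hrst heq.symm
  have h4 := eq_or_eq_of_one_nonunit hp2 hn hr'0 hr'u ht' hs' (by linear_combination hrst') hr0 hru hs ht hrst
    (heq.symm.trans (fermatCMType_eq_of_multiset_eq (triple_swap₂₃ r' s' t')))
  have key : (s' = s ∧ t' = t) ∨ (s' = t ∧ t' = s) := by
    rcases h1 with h1 | h1
    · -- `s = s'`
      rcases h2 with h2 | h2
      · -- `t = s' = s`
        rcases h4 with h4 | h4
        · exact Or.inl ⟨h1.symm, h4.trans (h1.trans h2.symm)⟩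
        · exact Or.inl ⟨h1.symm, h4⟩
      · exact Or.inl ⟨h1.symm, h2.symm⟩
    · -- `s = t'`
      rcases h2 with h2 | h2
      · exact Or.inr ⟨h2.symm, h1.symm⟩
      · -- `t = t' = s`
        rcases h3 with h3 | h3
        · exact Or.inl ⟨h3, h2.symm⟩
        · exact Or.inr ⟨h3, h1.symm⟩
  rcases key with ⟨e1, e2⟩ | ⟨e1, e2⟩
  · have er : r' = r := by linear_combination hrst' - hrst - e1 - e2
    rw [er, e1, e2]
  · have er : r' = r := by linear_combination hrst' - hrst - e1 - e2
    rw [er, e1, e2, triple_swap₂₃]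

end TwoMixed

/-! ## §5 The pattern of a triple, and THEOREM 1 (i) IN FULL at every odd prime-power level `pⁿ`, `p ≥ 5` -/

section FiveLe

variable {p : ℕ} [hp : Fact p.Prime] {n : ℕ}

/-- **The three possible patterns of a triple** of non-zero residues with sum `0` modulo `pⁿ`: all units ("the relatively prime
case"), all non-units (g.c.d. `> 1`), or — up to a permutation — exactly one non-unit ("the boundary cases"); two non-units and a
unit cannot sum to `0`. [cite: KoblitzRohrlich1978, §2 (p. 1187) and §3 (p. 1193)] -/
theorem pattern_of_triple (hn : n ≠ 0) {r s t : ZMod (p ^ n)} (hr0 : r ≠ 0) (hs0 : s ≠ 0) (ht0 : t ≠ 0) (hrst : r + s + t = 0) :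
    (IsUnit r ∧ IsUnit s ∧ IsUnit t) ∨ (¬IsUnit r ∧ ¬IsUnit s ∧ ¬IsUnit t) ∨
      ∃ a b c : ZMod (p ^ n), ({a, b, c} : Multiset (ZMod (p ^ n))) = {r, s, t} ∧ a ≠ 0 ∧ ¬IsUnit a ∧ IsUnit b ∧ IsUnit c ∧
        a + b + c = 0 := by
  -- reduction modulo `p` decides: a unit plus two residues, one of them a non-unit, summing to `0` forces the third to be a unit
  have key : ∀ {a b c : ZMod (p ^ n)}, a + b + c = 0 → IsUnit a → ¬IsUnit b → IsUnit c := by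
    intro a b c habc ha hb
    by_contra hc
    rw [not_isUnit_iff_castHom_eq_zero hn] at hb hc
    have h := congrArg (ZMod.castHom (dvd_pow_self p hn) (ZMod p)) habc
    rw [map_add, map_add, map_zero, hb, hc, add_zero, add_zero] at h
    exact (not_isUnit_iff_castHom_eq_zero hn a).2 h ha
  by_cases hr : IsUnit r <;> by_cases hs : IsUnit s <;> by_cases ht : IsUnit t
  · exact Or.inl ⟨hr, hs, ht⟩
  · exact Or.inr (Or.inr ⟨t, r, s, by rw [triple_swap₁₂, triple_swap₂₃], ht0, ht, hr, hs, by linear_combination hrst⟩)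
  · exact Or.inr (Or.inr ⟨s, r, t, triple_swap₁₂ s r t, hs0, hs, hr, ht, by linear_combination hrst⟩)
  · exact absurd (key hrst hr hs) ht
  · exact Or.inr (Or.inr ⟨r, s, t, rfl, hr0, hr, hs, ht, hrst⟩)
  · exact absurd (key (show s + t + r = 0 by linear_combination hrst) hs ht) hr
  · exact absurd (key (show t + r + s = 0 by linear_combination hrst) ht hr) hs
  · exact Or.inr (Or.inl ⟨hr, hs, ht⟩)

/-- **KOBLITZ–ROHRLICH THEOREM 1 (i) IN FULL AT ODD PRIME-POWER LEVEL `pⁿ`, `p ≥ 5` (relatively prime AND boundary cases).**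
For triples `τ = (r, s, t)`, `τ′ = (r′, s′, t′)` of non-zero residues modulo `pⁿ` with `r + s + t = 0 = r′ + s′ + t′` and a unit among
the six entries (g.c.d. `(r, s, t, r′, s′, t′) = 1`): **`H_{τ′} = H_τ` iff `τ′` is a permutation of `τ`** — here the non-trivial
direction.  The §3 PROPOSITION ("Let `2, 3 ∤ N` … Suppose `N` is not prime to `rstr′s′t′` … suppose `H_τ = H_{τ′}`.  Then `τ′` is a
permutation of `τ`") at `N = pⁿ` together with the relatively prime case (tree `fermatCMType_eq_iff_multiset_eq_primePow`).  Proof by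
the parity condition, NOT by K–R's estimates: a unit triple against a one-non-unit triple is impossible (`p^{v} ≤ 5` forces `p ∈
{3, 5}`, and `p = 5` dies modulo `5`), against an all-non-unit triple is impossible, one non-unit on each side forces equality.
[cite: KoblitzRohrlich1978, Theorem 1 (i) (p. 1185) and §3 Proposition (p. 1193)] -/
theorem multiset_eq_of_fermatCMType_eq_primePow_five_le (hp5 : 5 ≤ p) (hn : n ≠ 0) {r s t r' s' t' : ZMod (p ^ n)}
    (hr0 : r ≠ 0) (hs0 : s ≠ 0) (ht0 : t ≠ 0) (hrst : r + s + t = 0)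
    (hr'0 : r' ≠ 0) (hs'0 : s' ≠ 0) (ht'0 : t' ≠ 0) (hrst' : r' + s' + t' = 0)
    (hunit : IsUnit r ∨ IsUnit s ∨ IsUnit t ∨ IsUnit r' ∨ IsUnit s' ∨ IsUnit t')
    (heq : fermatCMType (p ^ n) r' s' t' = fermatCMType (p ^ n) r s t) :
    ({r', s', t'} : Multiset (ZMod (p ^ n))) = {r, s, t} := by
  have hp2 : p ≠ 2 := by omega
  have hp3 : p ≠ 3 := by omega
  -- the mixed configuration "units against one non-unit" is impossible for `p ≥ 5`
  have noAB : ∀ {a b c a' b' c' : ZMod (p ^ n)}, IsUnit a → IsUnit b → IsUnit c → a + b + c = 0 → a' ≠ 0 → ¬IsUnit a' →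
      IsUnit b' → IsUnit c' → a' + b' + c' = 0 → fermatCMType (p ^ n) a' b' c' = fermatCMType (p ^ n) a b c → False := by
    intro a b c a' b' c' ha hb hc habc ha'0 ha'u hb' hc' habc' h
    by_cases hp5' : p = 5
    · subst hp5'
      exact false_of_fibre_five hn ha hb hc habc ha'0 ha'u hb' hc' habc' h
    · exact false_of_fibre_of_seven_le hp2 hp3 hp5' hn ha hb hc habc ha'0 ha'u hb' hc' habc' h
  rcases pattern_of_triple hn hr0 hs0 ht0 hrst with ⟨hr, hs, ht⟩ | ⟨hr, hs, ht⟩ | ⟨a, b, c, habc, ha0, hau, hb, hc, hsum⟩ <;>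
    rcases pattern_of_triple hn hr'0 hs'0 ht'0 hrst' with ⟨hr', hs', ht'⟩ | ⟨hr', hs', ht'⟩ | ⟨a', b', c', habc', ha'0, ha'u, hb', hc', hsum'⟩
  · exact (fermatCMType_eq_iff_multiset_eq_primePow hp2 hn hr hs ht hrst hr' hs' ht' hrst').1 heq
  · exact (false_of_units_of_nonunits hp2 hn hr hs ht hrst hr'0 hs'0 ht'0 hr' hs' ht' hrst' heq).elim
  · exact (noAB hr hs ht hrst ha'0 ha'u hb' hc' hsum' ((fermatCMType_eq_of_multiset_eq habc').trans heq)).elim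
  · exact (false_of_units_of_nonunits hp2 hn hr' hs' ht' hrst' hr0 hs0 ht0 hr hs ht hrst heq.symm).elim
  · exfalso
    rcases hunit with h | h | h | h | h | h
    exacts [hr h, hs h, ht h, hr' h, hs' h, ht' h]
  · exact (false_of_one_nonunit_of_nonunits hp2 hn ha'0 ha'u hb' hc' hsum' hr0 hs0 ht0 hr hs ht hrst
      (heq.symm.trans (fermatCMType_eq_of_multiset_eq habc'.symm))).elim
  · exact (noAB hr' hs' ht' hrst' ha0 hau hb hc hsum ((fermatCMType_eq_of_multiset_eq habc).trans heq.symm)).elim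
  · exact (false_of_one_nonunit_of_nonunits hp2 hn ha0 hau hb hc hsum hr'0 hs'0 ht'0 hr' hs' ht' hrst'
      (heq.trans (fermatCMType_eq_of_multiset_eq habc.symm))).elim
  · rw [← habc, ← habc']
    exact multiset_eq_of_one_nonunit hp2 hn ha0 hau hb hc hsum ha'0 ha'u hb' hc' hsum'
      ((fermatCMType_eq_of_multiset_eq habc').trans (heq.trans (fermatCMType_eq_of_multiset_eq habc.symm)))

end FiveLe

/-! ## §6 `p = 3`: the trapped fibre is K–R's pair — THEOREM 3 (the §4 Proposition) for EVERY `n` -/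

section Three

variable {n : ℕ}

/-- **`p = 3`: a unit triple against a one-non-unit triple IS K–R's pair.**  At level `N = 3ⁿ` let `τ = (r, s, t)` consist of
units, `τ′ = (r′, s′, t′)` have `r′ ≠ 0` a non-unit and `s′, t′` units, sums `0`, `H_{τ′} = H_τ`.  Then `v(r′) = 1`, the fibre
`{y : 3y = r′} = {c, cu, cu²}` (`u = 1 + 3ⁿ⁻¹`, `c = r′/3`) lies in `{r, s, t, −s′, −t′}` with exactly two members among `r, s, t`,
and for a unit `w`: `{wr, ws, wt} = {1, N₁ − 2, 2N₁ + 1}` and `{wr′, ws′, wt′} = {3, 2N₁ − 1, N₁ − 2}` as multisets (`N₁ = 3ⁿ⁻¹`) —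
"`uτ` and `uτ′` are permutations of `(1, N₁ − 2, 2N₁ + 1)` and `(3, N₁ − 2, 2N₁ − 1)`".  (K–R's §4 Case 4, reached here from the
parity condition instead of the residue computations of pp. 1199–1200.) [cite: KoblitzRohrlich1978, §4 Proposition and Case 4 (pp. 1198–1200); Theorem 3 (p. 1186)] -/
theorem exceptional_of_fibre_three (hn : n ≠ 0) {r s t r' s' t' : ZMod (3 ^ n)}
    (hr : IsUnit r) (hs : IsUnit s) (ht : IsUnit t) (hrst : r + s + t = 0)
    (hr'0 : r' ≠ 0) (hr'u : ¬IsUnit r') (hs' : IsUnit s') (ht' : IsUnit t') (hrst' : r' + s' + t' = 0)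
    (heq : fermatCMType (3 ^ n) r' s' t' = fermatCMType (3 ^ n) r s t) :
    ∃ w : ZMod (3 ^ n), IsUnit w ∧
      ({w * r, w * s, w * t} : Multiset (ZMod (3 ^ n))) = {1, (3 : ZMod (3 ^ n)) ^ (n - 1) - 2, 2 * (3 : ZMod (3 ^ n)) ^ (n - 1) + 1} ∧
      ({w * r', w * s', w * t'} : Multiset (ZMod (3 ^ n))) = {3, 2 * (3 : ZMod (3 ^ n)) ^ (n - 1) - 1, (3 : ZMod (3 ^ n)) ^ (n - 1) - 2} := by
  classical
  haveI h3 : Fact (Nat.Prime 3) := ⟨Nat.prime_three⟩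
  haveI : Fact (1 < 3 ^ n) := ⟨Nat.one_lt_pow hn (by norm_num)⟩
  obtain ⟨hk1, -, hn2⟩ := factorization_eq_one_of_fibre (p := 3) (by norm_num) hn hr hs ht hrst hr'0 hr'u hs' ht' hrst' heq
  obtain ⟨hk, r₀, hr₀, er⟩ := exists_eq_pow_mul_unit_primePow hr'0
  rw [hk1] at hk er
  rw [pow_one] at er
  -- notation: `P = 3ⁿ⁻¹`, the relations `3P = 0`, `P² = 0`
  set P : ZMod (3 ^ n) := ((3 : ℕ) : ZMod (3 ^ n)) ^ (n - 1) with hP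
  have hP3 : ((3 : ℕ) : ZMod (3 ^ n)) * P = 0 := by
    rw [hP, ← pow_succ', Nat.sub_add_cancel (Nat.pos_of_ne_zero hn), ← Nat.cast_pow, ZMod.natCast_self]
  have hPP : P * P = 0 := by
    rw [hP, ← pow_add, ← Nat.cast_pow, ZMod.natCast_eq_zero_iff]
    exact pow_dvd_pow 3 (by omega)
  have h3c : ((3 : ℕ) : ZMod (3 ^ n)) = 3 := by norm_num
  -- the three fibre elements `c_m = (1 + mP)·r₀`
  set g : ℕ → ZMod (3 ^ n) := fun m => 1 + (m : ZMod (3 ^ n)) * ((3 : ℕ) : ZMod (3 ^ n)) ^ (n - 1) with hg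
  have hgp : ∀ m, g m * ((3 : ℕ) : ZMod (3 ^ n)) = (3 : ℕ) := fun m => one_add_mul_pow_mul_p (p := 3) hn _
  have hgu : ∀ m, IsUnit (g m) := fun m => isUnit_one_add_mul_pow (p := 3) hn2 _
  have hψ : ∀ m, ZMod.castHom (dvd_pow_self 3 hn) (ZMod 3) (g m * r₀) = ZMod.castHom (dvd_pow_self 3 hn) (ZMod 3) r₀ :=
    fun m => by rw [map_mul, hg, castHom_one_add_mul_pow (p := 3) hn2, one_mul]
  have hray : ∀ m, ((3 : ℕ) : ZMod (3 ^ n)) ^ (r'.val.factorization 3) * (g m * r₀) = r' := fun m => by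
    rw [hk1, pow_one, er, ← mul_assoc, mul_comm ((3 : ℕ) : ZMod (3 ^ n)) (g m), hgp]
  have hmem : ∀ m, g m * r₀ = r ∨ g m * r₀ = s ∨ g m * r₀ = t ∨ g m * r₀ = -s' ∨ g m * r₀ = -t' := fun m =>
    mem_five_of_fibre (p := 3) (by norm_num) hn hr hs ht hrst hr'0 hr'u hs' ht' hrst' heq (hray m)
  have hinj : ∀ {i j : ℕ}, i < 3 → j < 3 → g i * r₀ = g j * r₀ → i = j := by
    intro i j hi hj h
    rw [mul_comm (g i), mul_comm (g j)] at h
    exact mul_one_add_mul_pow_injective (p := 3) hn hr₀ hi hj h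
  have hne : ZMod.castHom (dvd_pow_self 3 hn) (ZMod 3) s' ≠ ZMod.castHom (dvd_pow_self 3 hn) (ZMod 3) t' := by
    refine castHom_ne_of_add_not_isUnit (p := 3) (by norm_num) hn hs' ?_
    rw [show s' + t' = -r' by linear_combination hrst', IsUnit.neg_iff]
    exact hr'u
  -- `T`-membership of the `c_m`
  have X : ∀ {i j : ℕ}, i < 3 → j < 3 → i ≠ j → ¬(g i * r₀ = r ∨ g i * r₀ = s ∨ g i * r₀ = t) →
      ¬(g j * r₀ = r ∨ g j * r₀ = s ∨ g j * r₀ = t) → False := by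
    intro i j hi hj hij hi' hj'
    have hi2 : g i * r₀ = -s' ∨ g i * r₀ = -t' := by
      rcases hmem i with h | h | h | h | h
      exacts [absurd (Or.inl h) hi', absurd (Or.inr (Or.inl h)) hi', absurd (Or.inr (Or.inr h)) hi', Or.inl h, Or.inr h]
    have hj2 : g j * r₀ = -s' ∨ g j * r₀ = -t' := by
      rcases hmem j with h | h | h | h | h
      exacts [absurd (Or.inl h) hj', absurd (Or.inr (Or.inl h)) hj', absurd (Or.inr (Or.inr h)) hj', Or.inl h, Or.inr h]
    rcases hi2 with hi2 | hi2 <;> rcases hj2 with hj2 | hj2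
    · exact hij (hinj hi hj (hi2.trans hj2.symm))
    · apply hne
      have h := (hψ i).trans (hψ j).symm
      rw [hi2, hj2, map_neg, map_neg, neg_inj] at h
      exact h
    · apply hne
      have h := (hψ j).trans (hψ i).symm
      rw [hi2, hj2, map_neg, map_neg, neg_inj] at h
      exact h
    · exact hij (hinj hi hj (hi2.trans hj2.symm))
  have hsum3 : g 0 * r₀ + g 1 * r₀ + g 2 * r₀ = r' := by
    rw [er, hg]
    push_cast
    linear_combination r₀ * hP3
  have Y : ¬((g 0 * r₀ = r ∨ g 0 * r₀ = s ∨ g 0 * r₀ = t) ∧ (g 1 * r₀ = r ∨ g 1 * r₀ = s ∨ g 1 * r₀ = t) ∧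
      (g 2 * r₀ = r ∨ g 2 * r₀ = s ∨ g 2 * r₀ = t)) := by
    rintro ⟨h0, h1, h2⟩
    have h01 : g 0 * r₀ ≠ g 1 * r₀ := fun h => absurd (hinj (by norm_num) (by norm_num) h) (by norm_num)
    have h02 : g 0 * r₀ ≠ g 2 * r₀ := fun h => absurd (hinj (by norm_num) (by norm_num) h) (by norm_num)
    have h12 : g 1 * r₀ ≠ g 2 * r₀ := fun h => absurd (hinj (by norm_num) (by norm_num) h) (by norm_num)
    have e := triple_eq_of_mem_of_mem ((mem_triple_iff r s t _).2 h0) ((mem_triple_iff r s t _).2 h1) h01 hrst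
    have h2' : g 2 * r₀ ∈ ({r, s, t} : Multiset (ZMod (3 ^ n))) := (mem_triple_iff r s t _).2 h2
    rw [e, mem_triple_iff] at h2'
    rcases h2' with h | h | h
    · exact h02 h.symm
    · exact h12 h.symm
    · apply hr'0
      rw [← hsum3]
      linear_combination h
  -- the finishing computation, for the three positions `l` of the member of `{−s′, −t′}`
  obtain ⟨w₀, hw₀⟩ := hr₀.exists_left_inv
  have hw₀u : IsUnit w₀ := IsUnit.of_mul_eq_one r₀ hw₀
  have finish : ∀ {i j l : ℕ}, i < 3 → j < 3 → l < 3 → i ≠ j →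
      (g i * r₀ = r ∨ g i * r₀ = s ∨ g i * r₀ = t) → (g j * r₀ = r ∨ g j * r₀ = s ∨ g j * r₀ = t) →
      ¬(g l * r₀ = r ∨ g l * r₀ = s ∨ g l * r₀ = t) →
      ({r, s, t} : Multiset (ZMod (3 ^ n))) = {g i * r₀, g j * r₀, -(g i * r₀) - g j * r₀} ∧
        ({r', s', t'} : Multiset (ZMod (3 ^ n))) = {r', -(g l * r₀), -r' - -(g l * r₀)} := by
    intro i j l hi hj hl hij hi' hj' hl'
    have hij' : g i * r₀ ≠ g j * r₀ := fun h => hij (hinj hi hj h)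
    refine ⟨triple_eq_of_mem_of_mem ((mem_triple_iff r s t _).2 hi') ((mem_triple_iff r s t _).2 hj') hij' hrst, ?_⟩
    have hl2 : g l * r₀ = -s' ∨ g l * r₀ = -t' := by
      rcases hmem l with h | h | h | h | h
      exacts [absurd (Or.inl h) hl', absurd (Or.inr (Or.inl h)) hl', absurd (Or.inr (Or.inr h)) hl', Or.inl h, Or.inr h]
    have hmem' : -(g l * r₀) ∈ ({r', s', t'} : Multiset (ZMod (3 ^ n))) := by
      rw [mem_triple_iff]
      rcases hl2 with h | h
      · exact Or.inr (Or.inl (by rw [h, neg_neg]))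
      · exact Or.inr (Or.inr (by rw [h, neg_neg]))
    have hne' : r' ≠ -(g l * r₀) := fun h => hr'u (by rw [h]; exact ((hgu l).mul hr₀).neg)
    exact triple_eq_of_mem_of_mem ((mem_triple_iff r' s' t' r').2 (Or.inl rfl)) hmem' hne' hrst'
  -- rewrite everything in terms of `P = 3ⁿ⁻¹` (numeral form) and finish in the three possible positions
  have hPP' : P = (3 : ZMod (3 ^ n)) ^ (n - 1) := by rw [hP, h3c]
  have hg0 : g 0 = 1 := by rw [hg]; simp
  have hg1 : g 1 = 1 + P := by rw [hg]; simp [hP]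
  have hg2 : g 2 = 1 + 2 * P := by rw [hg]; push_cast; rw [hP]; ring
  have er' : r' = 3 * r₀ := by rw [er, h3c]
  have hP3' : (3 : ZMod (3 ^ n)) * P = 0 := by rw [← h3c]; exact hP3
  have hu1 : IsUnit (1 + P) := by rw [← hg1]; exact hgu 1
  have hu2 : IsUnit (1 + 2 * P) := by rw [← hg2]; exact hgu 2
  rw [← hPP']
  by_cases h0 : g 0 * r₀ = r ∨ g 0 * r₀ = s ∨ g 0 * r₀ = t <;>
    by_cases h1 : g 1 * r₀ = r ∨ g 1 * r₀ = s ∨ g 1 * r₀ = t <;>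
      by_cases h2 : g 2 * r₀ = r ∨ g 2 * r₀ = s ∨ g 2 * r₀ = t
  · exact (Y ⟨h0, h1, h2⟩).elim
  · -- `l = 2`, `(i, j) = (0, 1)`: `w = r₀⁻¹ u²`
    obtain ⟨eτ, eτ'⟩ := finish (i := 0) (j := 1) (l := 2) (by norm_num) (by norm_num) (by norm_num) (by norm_num) h0 h1 h2
    rw [hg0, hg1, one_mul] at eτ
    rw [hg2] at eτ'
    refine ⟨w₀ * (1 + 2 * P), hw₀u.mul hu2, ?_, ?_⟩
    · have e1 : w₀ * (1 + 2 * P) * r₀ = 2 * P + 1 := by linear_combination (1 + 2 * P) * hw₀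
      have e2 : w₀ * (1 + 2 * P) * ((1 + P) * r₀) = 1 := by
        linear_combination (1 + 3 * P + 2 * P ^ 2) * hw₀ + hP3' + 2 * hPP
      have e3 : w₀ * (1 + 2 * P) * (-r₀ - (1 + P) * r₀) = P - 2 := by
        linear_combination (-(2 + 5 * P + 2 * P ^ 2)) * hw₀ - 2 * hP3' - 2 * hPP
      rw [← map_mul_triple₃, eτ, map_mul_triple₃, e1, e2, e3, triple_swap₁₂, triple_swap₂₃]
    · have e1 : w₀ * (1 + 2 * P) * (3 * r₀) = 3 := by linear_combination (3 + 6 * P) * hw₀ + 2 * hP3'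
      have e2 : w₀ * (1 + 2 * P) * -((1 + 2 * P) * r₀) = 2 * P - 1 := by
        linear_combination (-(1 + 4 * P + 4 * P ^ 2)) * hw₀ - 2 * hP3' - 4 * hPP
      have e3 : w₀ * (1 + 2 * P) * (-(3 * r₀) - -((1 + 2 * P) * r₀)) = P - 2 := by
        linear_combination (-(2 + 2 * P - 4 * P ^ 2)) * hw₀ - hP3' + 4 * hPP
      rw [← map_mul_triple₃, eτ', er', map_mul_triple₃, e1, e2, e3]
  · -- `l = 1`, `(i, j) = (0, 2)`: `w = r₀⁻¹`
    obtain ⟨eτ, eτ'⟩ := finish (i := 0) (j := 2) (l := 1) (by norm_num) (by norm_num) (by norm_num) (by norm_num) h0 h2 h1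
    rw [hg0, hg2, one_mul] at eτ
    rw [hg1] at eτ'
    refine ⟨w₀, hw₀u, ?_, ?_⟩
    · have e1 : w₀ * r₀ = 1 := hw₀
      have e2 : w₀ * ((1 + 2 * P) * r₀) = 2 * P + 1 := by linear_combination (1 + 2 * P) * hw₀
      have e3 : w₀ * (-r₀ - (1 + 2 * P) * r₀) = P - 2 := by linear_combination (-(2 + 2 * P)) * hw₀ - hP3'
      rw [← map_mul_triple₃, eτ, map_mul_triple₃, e1, e2, e3, triple_swap₂₃ (1 : ZMod (3 ^ n))]
    · have e1 : w₀ * (3 * r₀) = 3 := by linear_combination 3 * hw₀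
      have e2 : w₀ * -((1 + P) * r₀) = 2 * P - 1 := by linear_combination (-(1 + P)) * hw₀ - hP3'
      have e3 : w₀ * (-(3 * r₀) - -((1 + P) * r₀)) = P - 2 := by linear_combination (-(2 - P)) * hw₀
      rw [← map_mul_triple₃, eτ', er', map_mul_triple₃, e1, e2, e3]
  · exact (X (i := 1) (j := 2) (by norm_num) (by norm_num) (by norm_num) h1 h2).elim
  · -- `l = 0`, `(i, j) = (1, 2)`: `w = r₀⁻¹ u`
    obtain ⟨eτ, eτ'⟩ := finish (i := 1) (j := 2) (l := 0) (by norm_num) (by norm_num) (by norm_num) (by norm_num) h1 h2 h0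
    rw [hg1, hg2] at eτ
    rw [hg0, one_mul] at eτ'
    refine ⟨w₀ * (1 + P), hw₀u.mul hu1, ?_, ?_⟩
    · have e1 : w₀ * (1 + P) * ((1 + P) * r₀) = 2 * P + 1 := by linear_combination (1 + 2 * P + P ^ 2) * hw₀ + hPP
      have e2 : w₀ * (1 + P) * ((1 + 2 * P) * r₀) = 1 := by
        linear_combination (1 + 3 * P + 2 * P ^ 2) * hw₀ + hP3' + 2 * hPP
      have e3 : w₀ * (1 + P) * (-((1 + P) * r₀) - (1 + 2 * P) * r₀) = P - 2 := by
        linear_combination (-(2 + 5 * P + 3 * P ^ 2)) * hw₀ - 2 * hP3' - 3 * hPP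
      rw [← map_mul_triple₃, eτ, map_mul_triple₃, e1, e2, e3, triple_swap₁₂, triple_swap₂₃]
    · have e1 : w₀ * (1 + P) * (3 * r₀) = 3 := by linear_combination (3 + 3 * P) * hw₀ + hP3'
      have e2 : w₀ * (1 + P) * -r₀ = 2 * P - 1 := by linear_combination (-(1 + P)) * hw₀ - hP3'
      have e3 : w₀ * (1 + P) * (-(3 * r₀) - -r₀) = P - 2 := by linear_combination (-(2 + 2 * P)) * hw₀ - hP3'
      rw [← map_mul_triple₃, eτ', er', map_mul_triple₃, e1, e2, e3]
  · exact (X (i := 0) (j := 2) (by norm_num) (by norm_num) (by norm_num) h0 h2).elim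
  · exact (X (i := 0) (j := 1) (by norm_num) (by norm_num) (by norm_num) h0 h1).elim
  · exact (X (i := 0) (j := 1) (by norm_num) (by norm_num) (by norm_num) h0 h1).elim

/-- **KOBLITZ–ROHRLICH THEOREM 3 — the §4 PROPOSITION — FOR EVERY `n`.**  "PROPOSITION. Let `N = 3ⁿ`, `N₁ = 3ⁿ⁻¹`, `τ = (r, s, t)`,
`τ′ = (r′, s′, t′)`, `H_τ = H_{τ′}`.  Suppose that `τ′` is not a permutation of `τ`, and that g.c.d.`(r, s, t, r′, s′, t′) = 1`.  Then for
some `u ∈ (ℤ/Nℤ)*`, `uτ = (⟨ur⟩, ⟨us⟩, ⟨ut⟩)` and `uτ′` are permutations of `(1, N₁ − 2, 2N₁ + 1)` and `(3, N₁ − 2, 2N₁ − 1)`."  Tree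
form: for triples of non-zero residues modulo `3ⁿ` (`n ≥ 1`) with `r + s + t = 0 = r′ + s′ + t′`, a unit among the six entries and
`H_{τ′} = H_τ`, EITHER `{r′, s′, t′} = {r, s, t}` OR there is a unit `w` with `{wr, ws, wt} = {1, N₁ − 2, 2N₁ + 1}` and
`{wr′, ws′, wt′} = {3, 2N₁ − 1, N₁ − 2}`, or the same with `τ, τ′` exchanged (`N₁ = 3ⁿ⁻¹` as a residue).  The siblings had this by kernel
enumeration at `N = 9` and `N = 27` only (`perm_or_exists_unit_of_fermatCMType_eq_twentySeven`) and the existence half for every `n`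
(`fermatCMType_threePow_eq`); the proof here is by the parity condition, not by K–R's Cases 1–4.
[cite: KoblitzRohrlich1978, Theorem 3 (p. 1186) and §4 Proposition (pp. 1198–1200)] -/
theorem perm_or_exceptional_of_fermatCMType_eq_threePow (hn : n ≠ 0) {r s t r' s' t' : ZMod (3 ^ n)}
    (hr0 : r ≠ 0) (hs0 : s ≠ 0) (ht0 : t ≠ 0) (hrst : r + s + t = 0)
    (hr'0 : r' ≠ 0) (hs'0 : s' ≠ 0) (ht'0 : t' ≠ 0) (hrst' : r' + s' + t' = 0)
    (hunit : IsUnit r ∨ IsUnit s ∨ IsUnit t ∨ IsUnit r' ∨ IsUnit s' ∨ IsUnit t')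
    (heq : fermatCMType (3 ^ n) r' s' t' = fermatCMType (3 ^ n) r s t) :
    ({r', s', t'} : Multiset (ZMod (3 ^ n))) = {r, s, t} ∨
      ∃ w : ZMod (3 ^ n), IsUnit w ∧
        ((({w * r, w * s, w * t} : Multiset (ZMod (3 ^ n))) = {1, (3 : ZMod (3 ^ n)) ^ (n - 1) - 2, 2 * (3 : ZMod (3 ^ n)) ^ (n - 1) + 1} ∧
            ({w * r', w * s', w * t'} : Multiset (ZMod (3 ^ n))) = {3, 2 * (3 : ZMod (3 ^ n)) ^ (n - 1) - 1, (3 : ZMod (3 ^ n)) ^ (n - 1) - 2}) ∨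
          (({w * r, w * s, w * t} : Multiset (ZMod (3 ^ n))) = {3, 2 * (3 : ZMod (3 ^ n)) ^ (n - 1) - 1, (3 : ZMod (3 ^ n)) ^ (n - 1) - 2} ∧
            ({w * r', w * s', w * t'} : Multiset (ZMod (3 ^ n))) = {1, (3 : ZMod (3 ^ n)) ^ (n - 1) - 2, 2 * (3 : ZMod (3 ^ n)) ^ (n - 1) + 1})) := by
  haveI h3 : Fact (Nat.Prime 3) := ⟨Nat.prime_three⟩
  have hp2 : (3 : ℕ) ≠ 2 := by norm_num
  rcases pattern_of_triple (p := 3) hn hr0 hs0 ht0 hrst with ⟨hr, hs, ht⟩ | ⟨hr, hs, ht⟩ | ⟨a, b, c, habc, ha0, hau, hb, hc, hsum⟩ <;>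
    rcases pattern_of_triple (p := 3) hn hr'0 hs'0 ht'0 hrst' with
      ⟨hr', hs', ht'⟩ | ⟨hr', hs', ht'⟩ | ⟨a', b', c', habc', ha'0, ha'u, hb', hc', hsum'⟩
  · exact Or.inl ((fermatCMType_eq_iff_multiset_eq_primePow (p := 3) hp2 hn hr hs ht hrst hr' hs' ht' hrst').1 heq)
  · exact (false_of_units_of_nonunits (p := 3) hp2 hn hr hs ht hrst hr'0 hs'0 ht'0 hr' hs' ht' hrst' heq).elim
  · -- `τ` units, `τ′` one non-unit: K–R's pair
    obtain ⟨w, hw, hA, hB⟩ := exceptional_of_fibre_three hn hr hs ht hrst ha'0 ha'u hb' hc' hsum'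
      ((fermatCMType_eq_of_multiset_eq habc').trans heq)
    refine Or.inr ⟨w, hw, Or.inl ⟨hA, ?_⟩⟩
    rw [← map_mul_triple₃, ← habc', map_mul_triple₃, hB]
  · exact (false_of_units_of_nonunits (p := 3) hp2 hn hr' hs' ht' hrst' hr0 hs0 ht0 hr hs ht hrst heq.symm).elim
  · exfalso
    rcases hunit with h | h | h | h | h | h
    exacts [hr h, hs h, ht h, hr' h, hs' h, ht' h]
  · exact (false_of_one_nonunit_of_nonunits (p := 3) hp2 hn ha'0 ha'u hb' hc' hsum' hr0 hs0 ht0 hr hs ht hrst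
      (heq.symm.trans (fermatCMType_eq_of_multiset_eq habc'.symm))).elim
  · -- `τ` one non-unit, `τ′` units: K–R's pair, exchanged
    obtain ⟨w, hw, hA, hB⟩ := exceptional_of_fibre_three hn hr' hs' ht' hrst' ha0 hau hb hc hsum
      ((fermatCMType_eq_of_multiset_eq habc).trans heq.symm)
    refine Or.inr ⟨w, hw, Or.inr ⟨?_, hA⟩⟩
    rw [← map_mul_triple₃, ← habc, map_mul_triple₃, hB]
  · exact (false_of_one_nonunit_of_nonunits (p := 3) hp2 hn ha0 hau hb hc hsum hr'0 hs'0 ht'0 hr' hs' ht' hrst'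
      (heq.trans (fermatCMType_eq_of_multiset_eq habc.symm))).elim
  · left
    rw [← habc, ← habc']
    exact multiset_eq_of_one_nonunit (p := 3) hp2 hn ha0 hau hb hc hsum ha'0 ha'u hb' hc' hsum'
      ((fermatCMType_eq_of_multiset_eq habc').trans (heq.trans (fermatCMType_eq_of_multiset_eq habc.symm)))

/-- **The exceptional pair at `n = 2, 3, 4`**: `(1, N₁ − 2, 2N₁ + 1)`, `(3, 2N₁ − 1, N₁ − 2)` are `(1, 1, 7)`, `(3, 5, 1)` modulo `9`;
`(1, 7, 19)`, `(3, 17, 7)` modulo `27`; `(1, 25, 55)`, `(3, 53, 25)` modulo `81` — the pairs of the siblings' kernel enumerations and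
instances. [cite: KoblitzRohrlich1978, Theorem 3 (p. 1186)] -/
theorem exceptional_pair_values :
    ((1 : ZMod 9), (3 : ZMod 9) ^ (2 - 1) - 2, 2 * (3 : ZMod 9) ^ (2 - 1) + 1) = (1, 1, 7) ∧
      ((3 : ZMod 9), 2 * (3 : ZMod 9) ^ (2 - 1) - 1, (3 : ZMod 9) ^ (2 - 1) - 2) = (3, 5, 1) ∧
    ((1 : ZMod 27), (3 : ZMod 27) ^ (3 - 1) - 2, 2 * (3 : ZMod 27) ^ (3 - 1) + 1) = (1, 7, 19) ∧
      ((3 : ZMod 27), 2 * (3 : ZMod 27) ^ (3 - 1) - 1, (3 : ZMod 27) ^ (3 - 1) - 2) = (3, 17, 7) ∧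
    ((1 : ZMod 81), (3 : ZMod 81) ^ (4 - 1) - 2, 2 * (3 : ZMod 81) ^ (4 - 1) + 1) = (1, 25, 55) ∧
      ((3 : ZMod 81), 2 * (3 : ZMod 81) ^ (4 - 1) - 1, (3 : ZMod 81) ^ (4 - 1) - 2) = (3, 53, 25) := by
  refine ⟨?_, ?_, ?_, ?_, ?_, ?_⟩ <;> decide

end Three

end CyclotomicFermatCMType

end Literature.AlgebraicGeometry.ComplexMultiplication
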